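import Mathlib
import HarnessLib
import Summits.ValiantsHypothesis.ValiantsHypothesis.Theorems.LacunarySymmetroidMatrixDescartesProductPlusOneCrossingBudget

/-!
# LINE (A) `product_plus_one` — two real-variable lemmas for the θ-division chain: DOWN-CROSSINGS and RICCATI LEVEL SETS

Crux item stmt-ValiantsHypothesis-18050, every-K side (S5) (val-lit-p5 g15 memo `pub/val-lit/lmr/NOTE-p5g15-18050-LINEA-K4-oneSigned-riser.md` §4 (4)(iii),
§6 (F3)).  The last storey of the chain for the three-letter riser is the fact «`Π₄ = δ₂ + h` takes each value at most twice», where `h = W/U₄ > 0` obeys the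
Riccati-type equation `θh = h·(g − h)` with `g = θlog W − δ₂` STRICTLY INCREASING.  This file proves the abstract real-variable content:

* ★ `no_two_zeros_of_deriv_neg_at_zeros` — a function differentiable on `[u,v]` whose derivative is NEGATIVE at each of its zeros has NO two zeros there
  (the abstract twin of ✓ `euler_roots_Icc_le_one_of_down`; proof: local signs ✓ `exists_sign_nhds_of_hasDerivAt_neg` + the supremum of the non-positive set);
* ★★ `riccati_level_atMostTwice` — if `h > 0` and `x·h′(x) = h(x)·(g(x) − h(x))·ρ(x)` with `ρ > 0` and `g` strictly increasing (any differentiable `g`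
  with `g′ > 0`) on `[u,v] ⊂ (0,∞)`, then `h` takes NO value three times on `[u,v]` (Rolle ⇒ two zeros of `h − g`, each a strict down-crossing).

HONEST FRAMING: calculus only; it is the (F3) piece of the kernel route of the three-letter riser cell, cloud-agnostic; nothing closes; the K = 3 floor is untouched;
`VP ≠ VNP` NOT proved.  No definitions, no named facts; Mathlib + ✓ `…CrossingBudget` (local sign lemma) only.
-/

set_option linter.dupNamespace false

namespace Summit.ValiantsHypothesis.ValiantsHypothesis.Theorems.LacunarySymmetroidMatrixDescartes

namespace ProductPlusOne

open Set

/-- ★ **No two zeros when every zero is a strict down-crossing.**  `φ` differentiable on `[u,v]` with derivative `φ′`; if `φ′ t < 0` at every zero `t ∈ [u,v]`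
of `φ`, then `φ` does not vanish at two points `z < z′` of `[u,v]`. [folklore] -/
theorem no_two_zeros_of_deriv_neg_at_zeros {φ φ' : ℝ → ℝ} {u v : ℝ} (hder : ∀ t ∈ Icc u v, HasDerivAt φ (φ' t) t)
    (hdown : ∀ t ∈ Icc u v, φ t = 0 → φ' t < 0) {z z' : ℝ} (hz : u ≤ z) (hzz' : z < z') (hz' : z' ≤ v)
    (h0 : φ z = 0) (h0' : φ z' = 0) : False := by
  have hzI : z ∈ Icc u v := ⟨hz, hzz'.le.trans hz'⟩
  have hz'I : z' ∈ Icc u v := ⟨hz.trans hzz'.le, hz'⟩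
  have hcont : ContinuousOn φ (Icc z z') := fun t ht =>
    (hder t ⟨hz.trans ht.1, ht.2.trans hz'⟩).continuousAt.continuousWithinAt
  -- local signs near the two zeros
  obtain ⟨δ, hδ, _, hright⟩ := exists_sign_nhds_of_hasDerivAt_neg (hder z hzI) h0 (hdown z hzI h0)
  obtain ⟨δ', hδ', hleft', _⟩ := exists_sign_nhds_of_hasDerivAt_neg (hder z' hz'I) h0' (hdown z' hz'I h0')
  set a₁ := z + min (δ / 2) ((z' - z) / 3) with ha₁
  set b₁ := z' - min (δ' / 2) ((z' - z) / 3) with hb₁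
  have hm1 : 0 < min (δ / 2) ((z' - z) / 3) := lt_min (by linarith) (by linarith)
  have hm2 : 0 < min (δ' / 2) ((z' - z) / 3) := lt_min (by linarith) (by linarith)
  have hm1' : min (δ / 2) ((z' - z) / 3) ≤ (z' - z) / 3 := min_le_right _ _
  have hm2' : min (δ' / 2) ((z' - z) / 3) ≤ (z' - z) / 3 := min_le_right _ _
  have hm1'' : min (δ / 2) ((z' - z) / 3) ≤ δ / 2 := min_le_left _ _
  have hm2'' : min (δ' / 2) ((z' - z) / 3) ≤ δ' / 2 := min_le_left _ _
  have ha₁z : z < a₁ := by rw [ha₁]; linarith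
  have hb₁z' : b₁ < z' := by rw [hb₁]; linarith
  have hab : a₁ < b₁ := by rw [ha₁, hb₁]; linarith
  have hφa : φ a₁ < 0 := hright a₁ ha₁z (by rw [ha₁]; linarith)
  have hφb : 0 < φ b₁ := hleft' b₁ (by rw [hb₁]; linarith) hb₁z'
  -- the last point of `[a₁, b₁]` where `φ ≤ 0`
  set S : Set ℝ := {t | t ∈ Icc a₁ b₁ ∧ φ t ≤ 0} with hS
  have hSne : S.Nonempty := ⟨a₁, ⟨le_rfl, hab.le⟩, hφa.le⟩
  have hSbdd : BddAbove S := ⟨b₁, fun t ht => ht.1.2⟩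
  have hScl : IsClosed S := by
    have hc : ContinuousOn φ (Icc a₁ b₁) := hcont.mono (Icc_subset_Icc ha₁z.le hb₁z'.le)
    have : S = Icc a₁ b₁ ∩ φ ⁻¹' (Iic 0) := by
      ext t; simp only [hS, mem_setOf_eq, mem_inter_iff, mem_preimage, mem_Iic]
    rw [this]
    exact hc.preimage_isClosed_of_isClosed isClosed_Icc isClosed_Iic
  set w := sSup S with hw
  have hwS : w ∈ S := hScl.csSup_mem hSne hSbdd
  obtain ⟨⟨hwa, hwb⟩, hφw⟩ := hwS
  have hwlt : w < b₁ := lt_of_le_of_ne hwb (fun h => by rw [h] at hφw; exact absurd hφb (not_lt.mpr hφw))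
  -- to the right of `w`, `φ > 0`
  have hpos : ∀ t, w < t → t ≤ b₁ → 0 < φ t := by
    intro t hwt htb
    by_contra hle
    push Not at hle
    have htS : t ∈ S := ⟨⟨hwa.trans hwt.le, htb⟩, hle⟩
    exact absurd (le_csSup hSbdd htS) (not_le.mpr hwt)
  -- hence `φ w = 0` (else IVT gives a zero right of `w`)
  have hwI : w ∈ Icc u v := ⟨hz.trans (ha₁z.le.trans hwa), (hwb.trans hb₁z'.le).trans hz'⟩
  have hφw0 : φ w = 0 := by
    rcases eq_or_lt_of_le hφw with h | h
    · exact h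
    · exfalso
      have hc : ContinuousOn φ (Icc w b₁) := hcont.mono (Icc_subset_Icc (ha₁z.le.trans hwa) hb₁z'.le)
      obtain ⟨t, ht, hφt⟩ := intermediate_value_Ioo hwlt.le hc ⟨h, hφb⟩
      exact absurd hφt (hpos t ht.1 ht.2.le).ne'
  -- but `φ′ w < 0` forces `φ < 0` just right of `w`
  obtain ⟨δ'', hδ'', _, hright''⟩ := exists_sign_nhds_of_hasDerivAt_neg (hder w hwI) hφw0 (hdown w hwI hφw0)
  set t₀ := w + min (δ'' / 2) ((b₁ - w) / 2) with ht₀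
  have hmin : 0 < min (δ'' / 2) ((b₁ - w) / 2) := lt_min (by linarith) (by linarith)
  have hmin' : min (δ'' / 2) ((b₁ - w) / 2) ≤ δ'' / 2 := min_le_left _ _
  have hmin'' : min (δ'' / 2) ((b₁ - w) / 2) ≤ (b₁ - w) / 2 := min_le_right _ _
  have h1 : φ t₀ < 0 := hright'' t₀ (by rw [ht₀]; linarith) (by rw [ht₀]; linarith)
  have h2 : 0 < φ t₀ := hpos t₀ (by rw [ht₀]; linarith) (by rw [ht₀]; linarith)
  exact absurd h1 (not_lt.mpr h2.le)

/-- ★★ **Riccati level sets: each value at most twice.**  On `[u,v] ⊂ (0,∞)`: `h > 0` with derivative `h′`, `g` with derivative `g′ > 0`, `ρ > 0`, and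
`x·h′(x) = h(x)·(g(x) − h(x))·ρ(x)`.  Then `h` does not take one value `c` at three points `y₁ < y₂ < y₃` of `[u,v]`.  (At a critical point `h = g`;
every zero of `h − g` is a strict down-crossing since there `(h − g)′ = −g′ < 0`; two such zeros are impossible.) [this file's theorem] -/
theorem riccati_level_atMostTwice {h h' g g' ρ : ℝ → ℝ} {u v : ℝ} (hu : 0 < u)
    (hh : ∀ t ∈ Icc u v, HasDerivAt h (h' t) t) (hg : ∀ t ∈ Icc u v, HasDerivAt g (g' t) t)
    (hpos : ∀ t ∈ Icc u v, 0 < h t) (hg' : ∀ t ∈ Icc u v, 0 < g' t) (hρ : ∀ t ∈ Icc u v, 0 < ρ t)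
    (hric : ∀ t ∈ Icc u v, t * h' t = h t * (g t - h t) * ρ t)
    {c y₁ y₂ y₃ : ℝ} (h1 : u ≤ y₁) (h12 : y₁ < y₂) (h23 : y₂ < y₃) (h3 : y₃ ≤ v)
    (e1 : h y₁ = c) (e2 : h y₂ = c) (e3 : h y₃ = c) : False := by
  have hI : ∀ t, y₁ ≤ t → t ≤ y₃ → t ∈ Icc u v := fun t ha hb => ⟨h1.trans ha, hb.trans h3⟩
  -- two critical points of `h`
  have hcrit : ∀ a b, y₁ ≤ a → a < b → b ≤ y₃ → h a = h b → ∃ ξ, a < ξ ∧ ξ < b ∧ h ξ = g ξ := by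
    intro a b ha hab hb heq
    have hcont : ContinuousOn h (Icc a b) := fun t ht => (hh t (hI t (ha.trans ht.1) (ht.2.trans hb))).continuousAt.continuousWithinAt
    obtain ⟨ξ, hξ, hξ'⟩ := exists_hasDerivAt_eq_zero hab hcont heq (fun t ht => hh t (hI t (ha.trans ht.1.le) (ht.2.le.trans hb)))
    have hξI := hI ξ (ha.trans hξ.1.le) (hξ.2.le.trans hb)
    have hr := hric ξ hξI
    rw [hξ', mul_zero] at hr
    have hξ0 : 0 < ξ := hu.trans_le hξI.1
    -- 0 = h (g - h) ρ with h, ρ > 0 ⇒ g = h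
    have : g ξ - h ξ = 0 := by
      rcases mul_eq_zero.mp hr.symm with h' | h'
      · rcases mul_eq_zero.mp h' with h'' | h''
        · exact absurd h'' (hpos ξ hξI).ne'
        · exact h''
      · exact absurd h' (hρ ξ hξI).ne'
    exact ⟨ξ, hξ.1, hξ.2, by linarith⟩
  obtain ⟨ξ₁, ha1, hb1, he1⟩ := hcrit y₁ y₂ le_rfl h12 h23.le (e1.trans e2.symm)
  obtain ⟨ξ₂, ha2, hb2, he2⟩ := hcrit y₂ y₃ h12.le h23 le_rfl (e2.trans e3.symm)
  -- `φ = h − g` has derivative `h′ − g′`, negative at its zeros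
  refine no_two_zeros_of_deriv_neg_at_zeros (φ := fun t => h t - g t) (φ' := fun t => h' t - g' t) (u := y₁) (v := y₃)
    (fun t ht => (hh t (hI t ht.1 ht.2)).sub (hg t (hI t ht.1 ht.2))) ?_ ha1.le (hb1.trans ha2) hb2.le (sub_eq_zero.mpr he1)
    (sub_eq_zero.mpr he2)
  intro t ht hφ
  have htI := hI t ht.1 ht.2
  have ht0 : 0 < t := hu.trans_le htI.1
  have heq : h t = g t := sub_eq_zero.mp hφ
  have hr := hric t htI
  rw [heq, sub_self, mul_zero, zero_mul] at hr
  -- t·h′ t = 0 ⇒ h′ t = 0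
  have hh' : h' t = 0 := by
    rcases mul_eq_zero.mp hr with h'' | h''
    · exact absurd h'' ht0.ne'
    · exact h''
  show h' t - g' t < 0
  rw [hh']
  linarith [hg' t htI]

end ProductPlusOne

end Summit.ValiantsHypothesis.ValiantsHypothesis.Theorems.LacunarySymmetroidMatrixDescartes
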